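import Literature.IUT.HodgeArakelov.ThetaEvaluationSettingModelAssembly
import Literature.IUT.HodgeArakelov.CohomologyAutFunctorialityComp
import Literature.AnabelianGeometry.EtaleTheta.ConstantMultipleRigidity

/-!
# [IUTchII] Prop 2.2 (ii) at the MODEL: the pointed-inversion PAIR `(α, β)` and its actions `ρ`, `ρlim`
# (GAP row G-w4d010-2, residual (R1))

abc-iut cell (D-0068 WAVE-5, seat abc-iut-w5-d072; cone of [IUTchIII] Cor. 3.12; DAG node **IUTchII:Prop2.2(ii)**;
plan/GAP-LEDGER.md row G-w4d010-2, residual **(R1)** of D-G-w4d010-2d/2e; L6-lead §F v1.16a (a) GO 2026-08-26T01:17Z).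
S. Mochizuki, *Inter-universal Teichmüller theory II*, kurims manuscript (Dec. 2020): Prop. 2.2 (ii) p. 66 «the condition
of invariance with respect to ι»; Rmk. 1.4.1 (ii) p. 28 (the pointed inversion `ι` — a `Δ`-outer automorphism of `Π^tp`);
Rmk. 2.1.1 (i) p. 65 (`ι` reverses the `ℤ`-torsor of irreducible components); Cor. 1.12 (i) p. 57 «induces an “action up
to torsion”» (claim key `Mochizuki2012`, DISPUTED, D-0012). [EtTh] (S. Mochizuki, Publ. RIMS **45** (2009), refereed):
Thm. 1.6 (ii) p. 24 («`γ` induces an isomorphism `(Δ_Θ)α →̃ (Δ_Θ)β`» — abc-iut-L2-t1's `ThetaSetting.ThetaCompanion`),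
Def. 2.5 (i) p. 39, Def. 2.7 p. 41.

WHAT THE CONSUMER WANTS. abc-iut-w4-d010's closing theorem `prop22_ii'_model` (`ThetaEvaluationSettingModelAssembly.lean`,
p414140) proves the repaired `Prop22_ii'` at `D := etaleThetaDataOfSetting'` (abc-iut-L6-t1) from three groups of inputs;
group (R1) is «an automorphism pair `(α, β)` of `(Π^tp_X̲̲, (Π^tp_X)^Θ)` compatible with `φ` and `l·Δ_Θ`, stabilising `Π^tp_Ÿ̲̲`,
with `toLZ (α γ) = −1`, an additive automorphism `ρ` of `H¹` intertwining its transport `h1TopAut` through `h1Top`, and a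
compatible `ρlim` on the limit».

WHAT THIS FILE CONSTRUCTS (definitions are DATA; no `Prop`-valued definition, no new named fact).
§1 For ANY automorphism pair `(α, β)` over the model (`α : Π^tp_X̲̲ ≃ Π^tp_X̲̲`, `β : (Π^tp_X)^Θ ≃ (Π^tp_X)^Θ`, `β ∘ φ = φ ∘ α`,
   `β(l·Δ_Θ) = l·Δ_Θ`, `α(Π^tp_Ÿ̲̲) = Π^tp_Ÿ̲̲`): `pairRho` — THE additive automorphism `ρ` of `coh.H1 ⊤` (the `h1Top`-conjugate of
   `MulEquiv.ofBijective (h1TopAut …) (h1TopAut_bijective …)`, abc-iut-L6-t1 p412635 + abc-iut-w5-d072 p413596),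
   `pairRho_h1Top_symm` (= the consumer's `hρT`), `pairRhoLim` := abc-iut-L6-t1's `h1LimAutEquiv` (p412842) and
   `toLim_pairRho` (= the consumer's `hcompat`, via `toLim_h1TopAut`); `mem_PiYdd_iff_of_piYddCharacteristic` (the
   consumer's `hH` FOLLOWS from its own hypothesis (H1) `PiYddCharacteristic C`). Hence `prop22_ii'_model_of_pair`:
   d010's closing theorem with the binders `ρ, ρlim, hcompat, hρT, hH` REMOVED.
§2 The pair FROM [EtTh] DATA: for an automorphism `ι : Π^tp_X ≃ Π^tp_X` of abc-iut-L2-t1's §1 tempered group with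
   `ι(Π^tp_X̲̲) = Π^tp_X̲̲` and a theta companion `c : ThetaCompanion ι` (L2-t1, Thm. 1.6 (ii) shape): `inversionAlpha` := `ι|Π^tp_X̲̲`,
   `β := c.thetaIso`, `thetaCompanion_phi` (compatibility with `φ`), `mem_lDeltaTheta_iff_thetaCompanion` (`β(l·Δ_Θ) = l·Δ_Θ`
   from `c.map_deltaTheta`), `toLZ_inversionAlpha` (`toZ (ι g) = (toZ g)⁻¹ ⇒ toLZ (α g) = (toLZ g)⁻¹`, so a `toLZ`-generator
   goes to `−1`), the named transport `inversionTransport := h1TopAut … (inversionAlpha …) c.thetaIso …` (for the (R2)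
   `hroot` consumer, abc-iut-w4-d014 p415311), and `prop22_ii'_model_of_inversion`: `Prop22_ii'` at the model from
   `(ι, hι, c, hZ)` + the class-level [EtTh] Prop. 1.4 inputs (R2)(R3) ONLY.

WHAT STAYS A HYPOTHESIS (honest residual of (R1), recorded in plan/GAP-LEDGER.md as a disposition row): the DATUM
`ι ∈ Aut_top(Π^tp_X)` with (i) `ι(Π^tp_X̲̲) = Π^tp_X̲̲` — [EtTh] Def. 2.5 (i)'s second condition («compatible with the
`{±1}`-structure», which abc-iut-L2-t8's `DoubleUnderline` does not record, see its docstring), (ii) `toZ ∘ ι = toZ⁻¹`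
([IUTchII] Rmk. 2.1.1 (i)), and (iii) its theta companion ([EtTh] Thm. 1.6 (ii) at `γ := ι`). At abc-iut-L2-t1's
`MuTwoSetting` ([EtTh] Def. 1.7) `ι` is conjugation by `ε_±` (`epsPM`) restricted to `Π^tp_X` — §3 `epsPMConj` (a group
automorphism, unconditionally) and `epsPMInversion` (a TOPOLOGICAL automorphism, under the hypothesis `hind` that
`inclX : Π^tp_X ↪ Π^tp_C` induces the topology of `Π^tp_X` — not a field of that interface), with the specialised closing theorem
`prop22_ii'_model_of_epsPM`.
[claim: Mochizuki2012, status: disputed] Nothing here takes a side on [IUTchIII] Cor. 3.12; typed ≠ proved.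
-/

namespace Literature.IUT.HodgeArakelov

open Literature.AnabelianGeometry.EtaleTheta (ContH1 ThetaSetting)
open EtaleThetaDataOfSetting CohomologySystemOfContH1

noncomputable section

namespace EtaleThetaDataOfSetting

variable {p : ℕ} [Fact p.Prime] {D : Literature.AnabelianGeometry.EtaleTheta.ThetaSetting p}
  {E : D.EtaleThetaData} {l : ℕ} (C : E.DoubleUnderline l)

/-! ## §0. Subgroups stabilised by an automorphism (bookkeeping) -/

/-- If an automorphism `e` of a group maps a subgroup `H` ONTO itself, then membership in `H` is `e`-invariant
(`x ∈ H ↔ e x ∈ H`). [cite: NeukirchSchmidtWingberg2008, I §5] -/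
theorem mem_iff_apply_mem_of_map_eq {G : Type*} [Group G] (e : G ≃* G) (H : Subgroup G)
    (h : H.map e.toMonoidHom = H) (x : G) : x ∈ H ↔ e x ∈ H := by
  constructor
  · intro hx
    rw [← h]
    exact ⟨x, hx, rfl⟩
  · intro hx
    rw [← h] at hx
    obtain ⟨y, hy, hyx⟩ := hx
    have : y = x := e.injective hyx
    rwa [this] at hy

/-- At the model: the consumer's hypothesis `hH` («`α` stabilises `Π^tp_Ÿ̲̲`», iff form) FOLLOWS from its own named input
(H1) `PiYddCharacteristic C` (every topological automorphism of `Π^tp_X̲̲` maps `Π^tp_Ÿ̲̲` onto itself — [EtTh] Cor. 2.18 (i)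
shape, abc-iut-L6-t1). [cite: Mochizuki2012, Prop 1.4 p.27] -/
theorem mem_PiYdd_iff_of_piYddCharacteristic (hchar : PiYddCharacteristic C) (α : (Pi C) ≃ₜ* (Pi C)) (x : Pi C) :
    x ∈ PiYdd C ↔ α x ∈ PiYdd C :=
  mem_iff_apply_mem_of_map_eq α.toMulEquiv (PiYdd C) (hchar α) x

/-! ## §1. The actions `ρ`, `ρlim` of an automorphism PAIR `(α, β)` on `coh.H1 ⊤` and on `lim` -/

section Pair

variable (α : (Pi C) ≃ₜ* (Pi C)) (β : D.GtpTheta ≃ₜ* D.GtpTheta) (hφ : ∀ g, β (phi C g) = phi C (α g))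
  (hA : ∀ a : D.GtpTheta, a ∈ D.lDeltaTheta l ↔ β a ∈ D.lDeltaTheta l)
  (hH : ∀ x, x ∈ PiYdd C ↔ α x ∈ PiYdd C)

/-- **`ρ` of GAP row G-w4d010-2 (a)/(R1) at the model** ([IUTchII] Cor. 1.12 (i) p. 57 «induces an “action up to torsion”»;
Prop. 2.2 (ii) p. 66): THE additive automorphism of `coh.H1 ⊤ = H¹(Π_Ÿ(Π), (l·Δ_Θ)(Π))` induced by the automorphism pair
`(α, β)` — the `h1Top`-conjugate of the bijective transport `h1TopAut` (abc-iut-L6-t1 `h1TopAut`, bijective by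
abc-iut-w5-d072 `h1TopAut_bijective`). DEFINED. [cite: Mochizuki2012, Cor 1.12 (i) p.57] -/
def pairRho : (coh C).H1 ⊤ ≃+ (coh C).H1 ⊤ :=
  ((h1Top C).trans (MulEquiv.toAdditive (MulEquiv.ofBijective
      (h1TopAut (phi C) (D.lDeltaTheta l) (PiYdd C) α β hφ (fun a ha => (hA a).mp ha) hH)
      (h1TopAut_bijective (phi C) (D.lDeltaTheta l) (PiYdd C) α β hφ (fun a ha => (hA a).mp ha) hH hA)))).trans
    (h1Top C).symm

/-- `ρ` intertwines `h1TopAut` through the comparison `h1Top` (additive-tag form). [cite: Mochizuki2012, Cor 1.12 (i) p.57] -/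
theorem pairRho_symm_apply (y : Additive (ContH1 (phi C) (D.lDeltaTheta l) (PiYdd C ⊓ ⊤))) :
    pairRho C α β hφ hA hH ((h1Top C).symm y) =
      (h1Top C).symm (MonoidHom.toAdditive
        (h1TopAut (phi C) (D.lDeltaTheta l) (PiYdd C) α β hφ (fun a ha => (hA a).mp ha) hH) y) := by
  unfold pairRho
  rw [AddEquiv.trans_apply, AddEquiv.trans_apply, AddEquiv.apply_symm_apply]
  rfl

/-- **`ρ` intertwines `h1TopAut` through `h1Top`** — literally the consumer's hypothesis `hρT` of `prop22_ii'_model`.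
[cite: Mochizuki2012, Cor 1.12 (i) p.57] -/
theorem pairRho_h1Top_symm (x : ContH1 (phi C) (D.lDeltaTheta l) (PiYdd C ⊓ ⊤)) :
    pairRho C α β hφ hA hH ((h1Top C).symm (Additive.ofMul x)) =
      (h1Top C).symm (Additive.ofMul
        (h1TopAut (phi C) (D.lDeltaTheta l) (PiYdd C) α β hφ (fun a ha => (hA a).mp ha) hH x)) :=
  pairRho_symm_apply C α β hφ hA hH (Additive.ofMul x)

/-- **`ρlim` of GAP row G-w4d010-2 (a)/(R1) at the model**: the additive automorphism of
`coh.lim = lim_K H¹(Π_Ÿ(Π)|_K, (l·Δ_Θ)(Π))` induced by `(α, β)` — abc-iut-L6-t1's `h1LimAutEquiv` (p412842) at the model's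
cohomology system. DEFINED. [cite: Mochizuki2012, Cor 1.12 (i) p.57] -/
def pairRhoLim : (coh C).lim ≃+ (coh C).lim :=
  h1LimAutEquiv (phi C) (D.lDeltaTheta l) (PiYdd C) α β hφ hA hH

/-- **The compatibility square `toLim ∘ ρ = ρlim ∘ toLim`** — literally the consumer's hypothesis `hcompat` of
`prop22_ii'_model` (abc-iut-L6-t1 `toLim_h1TopAut` under the two comparisons). [cite: Mochizuki2012, Cor 1.12 (i) p.57] -/
theorem toLim_pairRho (x : (coh C).H1 ⊤) :
    (coh C).toLim ⊤ (pairRho C α β hφ hA hH x) = pairRhoLim C α β hφ hA hH ((coh C).toLim ⊤ x) := by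
  obtain ⟨y, rfl⟩ : ∃ y, x = (h1Top C).symm y := ⟨h1Top C x, ((h1Top C).symm_apply_apply x).symm⟩
  rw [pairRho_symm_apply]
  -- `pairRhoLim … z` is `h1LimAut … z` by `rfl` (`h1LimAutEquiv_apply`)
  exact toLim_h1TopAut (phi C) (D.lDeltaTheta l) (PiYdd C) α β hφ (fun a ha => (hA a).mp ha) hH y

end Pair

/-! ## §1′. [IUTchII] Prop 2.2 (ii)′ at the model from a BARE automorphism pair -/

/-- **IUTchII:Prop2.2(ii)′ at the model `Π_v := Π^tp_X̲̲`, from a bare automorphism pair** (kurims p. 66: «determines a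
specific `μ_{2l}`-orbit `θ^ι(Π_v) ⊆ θ(Π_v)` within the unique `{(l·ℤ)×μ_{2l}}`-orbit»): abc-iut-w4-d010's `prop22_ii'_model`
with the binders `ρ`, `ρlim`, `hcompat`, `hρT`, `hH` REMOVED — `ρ := pairRho`, `ρlim := pairRhoLim` are CONSTRUCTED from the
pair, the square is `toLim_pairRho`, and `hH` follows from (H1) `hchar`. Remaining inputs: (R1) the pair `(α, β)` with
`β ∘ φ = φ ∘ α`, `β(l·Δ_Θ) = l·Δ_Θ`, `toLZ (α γ) = −1`; (R2)(R3) the class-level [EtTh] Prop. 1.4 statements.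
[claim: Mochizuki2012, status: disputed] (IUTchII §2 Prop 2.2 (ii), kurims pp.65-67) -/
theorem prop22_ii'_model_of_pair [hN : (PiYdd C).Normal] (hC : D.Compat) (hS : D.Sec2Hyps)
    (hchar : PiYddCharacteristic C) (S : BadPlaceSetting.{0}) (eS : (Pi C) ≃ₜ* S.PiX) (hl : S.l = l)
    {T : TemperedCoverings S (Pi C)}
    (Dec : SubgraphDecomposition S T (etaleThetaDataOfSetting' C hC hS hchar S.toThetaSetting eS hl))
    -- (R1) the model pointed-inversion pair
    (α : (Pi C) ≃ₜ* (Pi C)) (β : D.GtpTheta ≃ₜ* D.GtpTheta) (hφ : ∀ g, β (phi C g) = phi C (α g))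
    (hA : ∀ a : D.GtpTheta, a ∈ D.lDeltaTheta l ↔ β a ∈ D.lDeltaTheta l)
    (γ ε : Pi C) (hγ : C.toLZ γ = Multiplicative.ofAdd 1) (hε₁ : (ε : D.PiTemp) ∈ D.GtpY)
    (hε₂ : (ε : D.PiTemp) ∉ D.GtpYdd) (hαγ : C.toLZ (α γ) = Multiplicative.ofAdd (-1))
    -- (R2) [EtTh] Prop. 1.4 (ii) at the class level
    (hsign : ∃ κ : ContH1 (phi C) (D.lDeltaTheta l) (PiYdd C ⊓ ⊤), κ ^ 2 = 1 ∧
      ContH1.conj (phi C) (D.lDeltaTheta l) ε (rootLiftClass C) = rootLiftClass C * κ)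
    (hroot : ∃ τ₀ : Pi C, (τ₀ : D.PiTemp) ∈ D.GtpY ∧
      h1TopAut (phi C) (D.lDeltaTheta l) (PiYdd C) α β hφ (fun a ha => (hA a).mp ha)
          (mem_PiYdd_iff_of_piYddCharacteristic C hchar α) (rootLiftClass C) =
        ContH1.conj (phi C) (D.lDeltaTheta l) τ₀ (rootLiftClass C))
    -- (R3) [EtTh] Prop. 1.4 (i)/(iii) at the class level
    (hfree : ∀ m n : ℤ, IsOfFinAddOrder
      ((h1Top C).symm (Additive.ofMul (ContH1.conj (phi C) (D.lDeltaTheta l) (γ ^ m) (rootLiftClass C))) -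
        (h1Top C).symm (Additive.ofMul (ContH1.conj (phi C) (D.lDeltaTheta l) (γ ^ n) (rootLiftClass C)))) →
      m = n) :
    Prop22_ii' Dec :=
  prop22_ii'_model C hC hS hchar S eS hl Dec α β hφ (fun a ha => (hA a).mp ha)
    (mem_PiYdd_iff_of_piYddCharacteristic C hchar α) γ ε hγ hε₁ hε₂ hαγ
    (pairRho C α β hφ hA (mem_PiYdd_iff_of_piYddCharacteristic C hchar α))
    (pairRhoLim C α β hφ hA (mem_PiYdd_iff_of_piYddCharacteristic C hchar α))
    (toLim_pairRho C α β hφ hA (mem_PiYdd_iff_of_piYddCharacteristic C hchar α))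
    (pairRho_h1Top_symm C α β hφ hA (mem_PiYdd_iff_of_piYddCharacteristic C hchar α))
    hsign hroot hfree

/-! ## §2. The pair from [EtTh] data: an automorphism `ι` of `Π^tp_X` stabilising `Π^tp_X̲̲`, with a theta companion -/

section Inversion

variable (ι : D.PiTemp ≃ₜ* D.PiTemp) (hι : C.Huu.map ι.toMulEquiv.toMonoidHom = C.Huu)

/-- **`α := ι|Π^tp_X̲̲`**: the restriction to `Π^tp_X̲̲ = C.Huu` of an automorphism `ι` of the [EtTh] §1 tempered group
`Π^tp_X` with `ι(Π^tp_X̲̲) = Π^tp_X̲̲` ([IUTchII] Rmk. 1.4.1 (ii) p. 28: the pointed inversion of `X̲̲`, a `Δ`-outer automorphism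
of `Π^tp_{X̲̲}`; [EtTh] Def. 2.5 (i) p. 39), as a topological-group automorphism of the model `Π := Π^tp_X̲̲`. DEFINED
(restriction + the subspace topology). [cite: Mochizuki2012, Rmk 1.4.1 (ii) p.28] -/
def inversionAlpha : (Pi C) ≃ₜ* (Pi C) where
  toMulEquiv := (ι.toMulEquiv.subgroupMap C.Huu).trans (MulEquiv.subgroupCongr hι)
  continuous_toFun := continuous_induced_rng.2 (by exact ι.continuous.comp continuous_subtype_val)
  continuous_invFun := continuous_induced_rng.2 (by exact ι.symm.continuous.comp continuous_subtype_val)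

/-- `inversionAlpha` is `ι` on underlying elements. [cite: Mochizuki2012, Rmk 1.4.1 (ii) p.28] -/
@[simp] theorem coe_inversionAlpha (g : Pi C) : ((inversionAlpha C ι hι g : Pi C) : D.PiTemp) = ι (g : D.PiTemp) :=
  rfl

/-- `inversionAlpha⁻¹` is `ι⁻¹` on underlying elements. [cite: Mochizuki2012, Rmk 1.4.1 (ii) p.28] -/
@[simp] theorem coe_inversionAlpha_symm (g : Pi C) :
    (((inversionAlpha C ι hι).symm g : Pi C) : D.PiTemp) = ι.symm (g : D.PiTemp) :=
  rfl

include hι in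
/-- Membership in `Π^tp_X̲̲` is `ι`-invariant. [cite: MochizukiEtTh2009, Def 2.5 (i) p.39] -/
theorem mem_Huu_iff (x : D.PiTemp) : x ∈ C.Huu ↔ ι x ∈ C.Huu :=
  mem_iff_apply_mem_of_map_eq ι.toMulEquiv C.Huu hι x

variable (c : ThetaSetting.ThetaCompanion ι)

/-- **`β ∘ φ = φ ∘ α`** for `β := c.thetaIso` the theta companion of `ι` ([EtTh] Thm. 1.6 (ii) «`γ` induces an isomorphism
of theta quotients», abc-iut-L2-t1 `ThetaCompanion.comm`) and `α := ι|Π^tp_X̲̲`. [cite: MochizukiEtTh2009, Thm 1.6 (ii) p.24] -/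
theorem thetaCompanion_phi (g : Pi C) : c.thetaIso (phi C g) = phi C (inversionAlpha C ι hι g) := by
  change c.thetaIso.toMulEquiv (D.toTheta (g : D.PiTemp)) = D.toTheta (ι.toMulEquiv (g : D.PiTemp))
  exact (c.comm (g : D.PiTemp)).symm

/-- **`β(l·Δ_Θ) = l·Δ_Θ`** for `β := c.thetaIso`: a theta companion maps `Δ_Θ` onto `Δ_Θ` (`c.map_deltaTheta`), hence the
`l`-th powers `l·Δ_Θ` onto themselves. [cite: MochizukiEtTh2009, Prop 2.12 (i) p.45] -/
theorem mem_lDeltaTheta_iff_thetaCompanion (n : ℕ) (a : D.GtpTheta) :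
    a ∈ D.lDeltaTheta n ↔ c.thetaIso a ∈ D.lDeltaTheta n := by
  constructor
  · rintro ⟨y, hy, rfl⟩
    exact ⟨c.thetaIso y, c.apply_mem ⟨y, hy⟩, by rw [map_pow]⟩
  · rintro ⟨y, hy, hya⟩
    -- `y = c.thetaIso y'` with `y' ∈ Δ_Θ`
    have hy' : y ∈ D.DeltaTheta.map c.thetaIso.toMulEquiv.toMonoidHom := by rw [c.map_deltaTheta]; exact hy
    obtain ⟨y', hy'mem, hy'eq⟩ := hy'
    refine ⟨y', hy'mem, c.thetaIso.injective ?_⟩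
    rw [map_pow, ← hya, ← hy'eq]
    rfl

/-- **`toLZ (α g) = (toLZ g)⁻¹`** when `ι` REVERSES the `ℤ`-torsor at `g` (`toZ (ι g) = (toZ g)⁻¹`; [IUTchII] Rmk. 2.1.1 (i)
p. 65: «the vertex labeled `0` is fixed by `ι_X`», `ι` acts by `−1` on `Z`): `toLZ = toZ/l` on `Π^tp_X̲̲` (abc-iut-L2-t8
`toZ_eq`). [claim: Mochizuki2012, status: disputed] (IUTchII §2 Rmk 2.1.1 (i), kurims p.65) -/
theorem toLZ_inversionAlpha (g : Pi C) (hZ : D.toZ (ι (g : D.PiTemp)) = (D.toZ (g : D.PiTemp))⁻¹) :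
    C.toLZ (inversionAlpha C ι hι g) = (C.toLZ g)⁻¹ := by
  have hl : (l : ℤ) ≠ 0 := by exact_mod_cast C.l_ne_zero
  change Multiplicative.ofAdd (C.zExp (inversionAlpha C ι hι g)) = (Multiplicative.ofAdd (C.zExp g))⁻¹
  rw [← ofAdd_neg]
  congr 1
  apply mul_left_cancel₀ hl
  rw [← C.toZ_eq, mul_neg, ← C.toZ_eq]
  change Multiplicative.toAdd (D.toZ (ι (g : D.PiTemp))) = _
  rw [hZ, toAdd_inv]

/-- A `toLZ`-generator `γ` (`toLZ γ = 1 ∈ ℤ`) is carried to `−1` when `ι` reverses the `ℤ`-torsor at `γ` — literally the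
consumer's hypothesis `hαγ`. [claim: Mochizuki2012, status: disputed] (IUTchII §2 Rmk 2.1.1 (i), kurims p.65) -/
theorem toLZ_inversionAlpha_generator (γ : Pi C) (hγ : C.toLZ γ = Multiplicative.ofAdd 1)
    (hZ : D.toZ (ι (γ : D.PiTemp)) = (D.toZ (γ : D.PiTemp))⁻¹) :
    C.toLZ (inversionAlpha C ι hι γ) = Multiplicative.ofAdd (-1) := by
  rw [toLZ_inversionAlpha C ι hι γ hZ, hγ, ← ofAdd_neg]

/-- **The transport `ρ₀ = h1TopAut` of the inversion** on `H¹(Π^tp_Ÿ̲̲ ∩ ⊤, l·Δ_Θ)`: abc-iut-L6-t1's `h1TopAut` at the pair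
`(ι|Π^tp_X̲̲, c.thetaIso)`, `Π^tp_Ÿ̲̲` being stabilised by (H1) `hchar` — the named term the (R2) `hroot` consumer
(abc-iut-w4-d014 `h1TopAut_eq_conj_of_coeffChange_eq`) instantiates. DEFINED (an abbreviation).
[cite: Mochizuki2012, Cor 1.12 (i) p.57] -/
abbrev inversionTransport (hchar : PiYddCharacteristic C) :
    ContH1 (phi C) (D.lDeltaTheta l) (PiYdd C ⊓ ⊤) →* ContH1 (phi C) (D.lDeltaTheta l) (PiYdd C ⊓ ⊤) :=
  h1TopAut (phi C) (D.lDeltaTheta l) (PiYdd C) (inversionAlpha C ι hι) c.thetaIso (thetaCompanion_phi C ι hι c)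
    (fun a ha => (mem_lDeltaTheta_iff_thetaCompanion ι c l a).mp ha) (mem_PiYdd_iff_of_piYddCharacteristic C hchar _)

/-- **IUTchII:Prop2.2(ii)′ at the model, from the inversion datum of [EtTh]** (kurims p. 66): for an automorphism `ι` of
`Π^tp_X` with `ι(Π^tp_X̲̲) = Π^tp_X̲̲` ([EtTh] Def. 2.5 (i)), a theta companion `c` of `ι` ([EtTh] Thm. 1.6 (ii)) and
`toZ (ι γ) = (toZ γ)⁻¹` at a `toLZ`-generator `γ` ([IUTchII] Rmk. 2.1.1 (i)), the repaired `Prop22_ii' Dec` HOLDS at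
`D := etaleThetaDataOfSetting'` given only the class-level [EtTh] Prop. 1.4 inputs (R2) `hsign`/`hroot`, (R3) `hfree`: the
pair is `(ι|Π^tp_X̲̲, c.thetaIso)`, and `ρ`, `ρlim`, the square, `hρT`, `hH`, `hφ`, `hA`, `hαγ` are all CONSTRUCTED/PROVED above.
[claim: Mochizuki2012, status: disputed] (IUTchII §2 Prop 2.2 (ii), kurims pp.65-67) -/
theorem prop22_ii'_model_of_inversion [hN : (PiYdd C).Normal] (hC : D.Compat) (hS : D.Sec2Hyps)
    (hchar : PiYddCharacteristic C) (S : BadPlaceSetting.{0}) (eS : (Pi C) ≃ₜ* S.PiX) (hl : S.l = l)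
    {T : TemperedCoverings S (Pi C)}
    (Dec : SubgraphDecomposition S T (etaleThetaDataOfSetting' C hC hS hchar S.toThetaSetting eS hl))
    -- (R1) reduced: the inversion `ι` of `Π^tp_X` stabilising `Π^tp_X̲̲`, its theta companion, and the `ℤ`-reversal at `γ`
    (γ ε : Pi C) (hγ : C.toLZ γ = Multiplicative.ofAdd 1) (hε₁ : (ε : D.PiTemp) ∈ D.GtpY)
    (hε₂ : (ε : D.PiTemp) ∉ D.GtpYdd) (hZ : D.toZ (ι (γ : D.PiTemp)) = (D.toZ (γ : D.PiTemp))⁻¹)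
    -- (R2) [EtTh] Prop. 1.4 (ii) at the class level
    (hsign : ∃ κ : ContH1 (phi C) (D.lDeltaTheta l) (PiYdd C ⊓ ⊤), κ ^ 2 = 1 ∧
      ContH1.conj (phi C) (D.lDeltaTheta l) ε (rootLiftClass C) = rootLiftClass C * κ)
    (hroot : ∃ τ₀ : Pi C, (τ₀ : D.PiTemp) ∈ D.GtpY ∧
      inversionTransport C ι hι c hchar (rootLiftClass C) = ContH1.conj (phi C) (D.lDeltaTheta l) τ₀ (rootLiftClass C))
    -- (R3) [EtTh] Prop. 1.4 (i)/(iii) at the class level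
    (hfree : ∀ m n : ℤ, IsOfFinAddOrder
      ((h1Top C).symm (Additive.ofMul (ContH1.conj (phi C) (D.lDeltaTheta l) (γ ^ m) (rootLiftClass C))) -
        (h1Top C).symm (Additive.ofMul (ContH1.conj (phi C) (D.lDeltaTheta l) (γ ^ n) (rootLiftClass C)))) →
      m = n) :
    Prop22_ii' Dec :=
  prop22_ii'_model_of_pair C hC hS hchar S eS hl Dec (inversionAlpha C ι hι) c.thetaIso
    (thetaCompanion_phi C ι hι c) (mem_lDeltaTheta_iff_thetaCompanion ι c l) γ ε hγ hε₁ hε₂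
    (toLZ_inversionAlpha_generator C ι hι γ hγ hZ) hsign hroot hfree

end Inversion

end EtaleThetaDataOfSetting

/-! ## §3. At [EtTh] Def. 1.7's `MuTwoSetting`: the candidate `ι` = conjugation by `ε_±` restricted to `Π^tp_X`

abc-iut-L2-t1's `MuTwoSetting` (`ConstantMultipleRigidity.lean`, [EtTh] Def. 1.7 p. 27) carries `Π^tp_C` (`GtpC`, the
tempered fundamental group of `C^log = X^log/{±1}`), the continuous injection `inclX : Π^tp_X ↪ Π^tp_C` with NORMAL open
image of index `2`, and a representative `epsPM ∈ Π^tp_C ∖ Π^tp_X` of `ε_± ∈ Gal(Ẍ/C)` (which lifts `−1`). Conjugation by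
`ε_±` therefore restricts to a GROUP automorphism `epsPMConj` of `Π^tp_X` (outer: `ε_± ∉ Π^tp_X`); it is a TOPOLOGICAL
automorphism as soon as `inclX` is an inducing map (the subspace topology — which print takes for granted for an open
subgroup of finite index, but which is NOT a field of the interface): `epsPMInversion`. This is the print-shaped candidate
for the datum `ι` of §2; the remaining inputs (`ι(Π^tp_X̲̲) = Π^tp_X̲̲`, the theta companion, `toZ ∘ ι = toZ⁻¹`) stay hypotheses. -/

namespace EtaleThetaDataOfSetting

variable {p : ℕ} [Fact p.Prime] (M : Literature.AnabelianGeometry.EtaleTheta.MuTwoSetting p)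

/-- **Conjugation by `ε_±` on `Π^tp_X`** ([EtTh] Def. 1.7 p. 27: `ε_± ∈ Gal(Ẍ/C)`, a representative `epsPM ∈ Π^tp_C ∖ Π^tp_X`;
`Π^tp_X ⊴ Π^tp_C` of index `2`): the group automorphism `x ↦ inclX⁻¹(ε_± · inclX(x) · ε_±⁻¹)` of `Π^tp_X` — an OUTER
automorphism (the pointed inversion of [IUTchII] Rmk. 1.4.1 (ii) at the level of `X`). DEFINED (pure algebra:
`MonoidHom.ofInjective` + `MulAut.conjNormal`). [cite: MochizukiEtTh2009, Def 1.7 p.27] -/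
def epsPMConj : M.PiTemp ≃* M.PiTemp :=
  haveI : M.inclX.range.Normal := M.range_inclX_normal
  (MonoidHom.ofInjective M.injective_inclX).trans
    ((MulAut.conjNormal (H := M.inclX.range) M.epsPM).trans (MonoidHom.ofInjective M.injective_inclX).symm)

/-- `inclX (ε_±-conjugate of x) = ε_± · inclX x · ε_±⁻¹`. [cite: MochizukiEtTh2009, Def 1.7 p.27] -/
theorem inclX_epsPMConj (x : M.PiTemp) : M.inclX (epsPMConj M x) = M.epsPM * M.inclX x * M.epsPM⁻¹ := by
  haveI : M.inclX.range.Normal := M.range_inclX_normal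
  unfold epsPMConj
  rw [MulEquiv.trans_apply, MulEquiv.trans_apply, MonoidHom.apply_ofInjective_symm, MulAut.conjNormal_apply,
    MonoidHom.ofInjective_apply]

/-- `inclX (ε_±⁻¹-conjugate of x) = ε_±⁻¹ · inclX x · ε_±` (the inverse automorphism). [cite: MochizukiEtTh2009, Def 1.7 p.27] -/
theorem inclX_epsPMConj_symm (x : M.PiTemp) :
    M.inclX ((epsPMConj M).symm x) = M.epsPM⁻¹ * M.inclX x * M.epsPM := by
  have h := inclX_epsPMConj M ((epsPMConj M).symm x)
  rw [MulEquiv.apply_symm_apply] at h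
  rw [h]
  group

variable (hind : Topology.IsInducing M.inclX)

include hind in
/-- A self-map of `Π^tp_X` that is `inclX`-conjugation by a fixed `g ∈ Π^tp_C` is continuous, PROVIDED `inclX : Π^tp_X ↪ Π^tp_C`
induces the topology of `Π^tp_X` (hypothesis `hind`; not a field of `MuTwoSetting`). [cite: MochizukiEtTh2009, Def 1.7 p.27] -/
theorem continuous_of_inclX_eq_conj (f : M.PiTemp → M.PiTemp) (g : M.GtpC)
    (hf : ∀ x, M.inclX (f x) = g * M.inclX x * g⁻¹) : Continuous f := by
  rw [hind.continuous_iff]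
  have h : (M.inclX ∘ f) = fun x => g * M.inclX x * g⁻¹ := funext hf
  rw [h]
  exact (continuous_const.mul M.continuous_inclX).mul continuous_const

/-- **The candidate inversion `ι := (ε_±-conjugation)|Π^tp_X` as a TOPOLOGICAL automorphism of `Π^tp_X`**, under the
hypothesis that `inclX` induces the topology of `Π^tp_X` ([EtTh] Def. 1.7 p. 27; [IUTchII] Rmk. 1.4.1 (ii) p. 28 «the unique
order two automorphism `ι_X` … corresponds … to the unique order two `Δ^tp`-outer automorphism of `Π^tp`»). DEFINED; feed it
to §2 as `ι`. [cite: MochizukiEtTh2009, Def 1.7 p.27] -/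
def epsPMInversion : M.PiTemp ≃ₜ* M.PiTemp where
  toMulEquiv := epsPMConj M
  continuous_toFun := continuous_of_inclX_eq_conj M hind _ M.epsPM (inclX_epsPMConj M)
  continuous_invFun := continuous_of_inclX_eq_conj M hind _ M.epsPM⁻¹ (fun x => by
    rw [inv_inv]; exact inclX_epsPMConj_symm M x)

/-- `epsPMInversion` is `epsPMConj` as a function. [cite: MochizukiEtTh2009, Def 1.7 p.27] -/
@[simp] theorem epsPMInversion_apply (x : M.PiTemp) : epsPMInversion M hind x = epsPMConj M x := rfl

/-- `inclX ∘ ι = conj(ε_±) ∘ inclX` for `ι := epsPMInversion`. [cite: MochizukiEtTh2009, Def 1.7 p.27] -/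
theorem inclX_epsPMInversion (x : M.PiTemp) :
    M.inclX (epsPMInversion M hind x) = M.epsPM * M.inclX x * M.epsPM⁻¹ :=
  inclX_epsPMConj M x

/-- **IUTchII:Prop2.2(ii)′ at the model over [EtTh] Def. 1.7's setting, with `ι := (ε_±-conjugation)|Π^tp_X`** (kurims p. 66):
the specialisation of `prop22_ii'_model_of_inversion` to `D := M.toThetaSetting`, `ι := epsPMInversion M hind`. The residual
(R1) inputs are then exactly: `hind` (topology of `Π^tp_X` induced from `Π^tp_C`), `hι` (`ε_±` normalises `Π^tp_X̲̲` — [EtTh]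
Def. 2.5 (i)'s `{±1}`-compatibility of the splitting), `c` (the theta companion of `ι`, [EtTh] Thm. 1.6 (ii)) and `hZ`
(`ε_±` reverses `Z` at `γ`, [IUTchII] Rmk. 2.1.1 (i)); plus (R2)(R3).
[claim: Mochizuki2012, status: disputed] (IUTchII §2 Prop 2.2 (ii), kurims pp.65-67) -/
theorem prop22_ii'_model_of_epsPM {E : M.toThetaSetting.EtaleThetaData} {l : ℕ} (C : E.DoubleUnderline l)
    [hN : (PiYdd C).Normal] (hC : M.toThetaSetting.Compat) (hS : M.toThetaSetting.Sec2Hyps)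
    (hchar : PiYddCharacteristic C) (S : BadPlaceSetting.{0}) (eS : (Pi C) ≃ₜ* S.PiX) (hl : S.l = l)
    {T : TemperedCoverings S (Pi C)}
    (Dec : SubgraphDecomposition S T (etaleThetaDataOfSetting' C hC hS hchar S.toThetaSetting eS hl))
    -- (R1) at Def. 1.7's setting: `ε_±` normalises `Π^tp_X̲̲`, the theta companion of `ι`, the `ℤ`-reversal at `γ`
    (hι : C.Huu.map (epsPMInversion M hind).toMulEquiv.toMonoidHom = C.Huu)
    (c : ThetaSetting.ThetaCompanion (epsPMInversion M hind))
    (γ ε : Pi C) (hγ : C.toLZ γ = Multiplicative.ofAdd 1) (hε₁ : (ε : M.PiTemp) ∈ M.toThetaSetting.GtpY)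
    (hε₂ : (ε : M.PiTemp) ∉ M.toThetaSetting.GtpYdd)
    (hZ : M.toZ (epsPMInversion M hind (γ : M.PiTemp)) = (M.toZ (γ : M.PiTemp))⁻¹)
    -- (R2) [EtTh] Prop. 1.4 (ii) at the class level
    (hsign : ∃ κ : ContH1 (phi C) (M.toThetaSetting.lDeltaTheta l) (PiYdd C ⊓ ⊤), κ ^ 2 = 1 ∧
      ContH1.conj (phi C) (M.toThetaSetting.lDeltaTheta l) ε (rootLiftClass C) = rootLiftClass C * κ)
    (hroot : ∃ τ₀ : Pi C, (τ₀ : M.PiTemp) ∈ M.toThetaSetting.GtpY ∧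
      inversionTransport C (epsPMInversion M hind) hι c hchar (rootLiftClass C) =
        ContH1.conj (phi C) (M.toThetaSetting.lDeltaTheta l) τ₀ (rootLiftClass C))
    -- (R3) [EtTh] Prop. 1.4 (i)/(iii) at the class level
    (hfree : ∀ m n : ℤ, IsOfFinAddOrder
      ((h1Top C).symm (Additive.ofMul
          (ContH1.conj (phi C) (M.toThetaSetting.lDeltaTheta l) (γ ^ m) (rootLiftClass C))) -
        (h1Top C).symm (Additive.ofMul
          (ContH1.conj (phi C) (M.toThetaSetting.lDeltaTheta l) (γ ^ n) (rootLiftClass C)))) →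
      m = n) :
    Prop22_ii' Dec :=
  prop22_ii'_model_of_inversion C (epsPMInversion M hind) hι c hC hS hchar S eS hl Dec γ ε hγ hε₁ hε₂ hZ
    hsign hroot hfree

end EtaleThetaDataOfSetting

end

end Literature.IUT.HodgeArakelov
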